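import Literature.NumberTheory.Kottwitz1992.InvolutionsLemma26Holds
import Mathlib.LinearAlgebra.BilinearForm.Orthogonal
import Mathlib.LinearAlgebra.Projection
import HarnessLib

/-!
# [Kottwitz1992, Lemma 2.6 (2) p. 380] Positive definite Hermitian modules: isometric iff isomorphic — DISCHARGED:
# `Kottwitz1992_2_6_2_iso_iff_holds`

Kernel-lane companion of the statement carpet ★ `Literature/NumberTheory/Kottwitz1992/Involutions.lean` (squad TK; builds on ★
`InvolutionsLemma26Holds`, Lemma 2.6 (1)): the named fact ★ `Involutions.Kottwitz1992_2_6_2_iso_iff` — «Two positive definite Hermitian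
`B`-modules are isomorphic as Hermitian `B`-modules if and only if they are isomorphic as `B`-modules» — is PROVED here.  THEOREMS ONLY (no
definition, no named fact, no `sorry`, no instance, no notation); cell hodgecm-mathlib, seat B-typ02 (g31); net debt −1.

R. E. Kottwitz, *Points on some Shimura varieties over finite fields*, J. Amer. Math. Soc. 5 (1992), Lemma 2.6 (2) p. 380, proof p. 381
L14–L19 (held `paper:doi-10-2307-2152772`, p0008 L45–L46, p0009 L14–L19).  THE PRINTED PROOF: «By Lemma 2.1 it is enough to show that any
two positive definite Hermitian forms on an irreducible `B`-module yield isomorphic Hermitian `B`-modules.  By the first part of the lemma the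
second form is a real multiple of the first.  Since both forms are positive definite, this multiple must be positive, hence is a square in
`ℝ`.  Therefore the second form is isomorphic to the first by multiplication by a real number.»  Formalised as the induction behind «by Lemma
2.1»: given a `B`-isomorphism `e : V₁ ≅ V₂`, split off an irreducible `S ≤ V₁` and its orthogonal complement `S^⊥` (`V₁ = S ⊕ S^⊥`, the form
being positive definite, §1), put `S₂ = e(S)`, `V₂ = S₂ ⊕ S₂^⊥`; on `S` the form of `V₁` and the pull-back of the form of `V₂` along `e` are
positive multiples `r₁ φ₀`, `r₂ φ₀` of one form (★ `Kottwitz1992_2_6_1_hermitianForms_rank_one_holds`), so `√(r₁/r₂) · e|_S : S → S₂` is an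
isometry (§2, «multiplication by a real number»); `S^⊥ ≅ V₁/S ≅ V₂/S₂ ≅ S₂^⊥` as `B`-modules, so by induction on `dim_ℝ V₁` there is an isometry
`S^⊥ → S₂^⊥`; the two glue along the orthogonal decompositions (§2).
HONEST LABEL: HC_CM is proved only modulo the 7 printed citations (2 remaining: hLiu418, h413) until rung 0 closes; this file adds no citation
debt (0 facts, 0 sorry) and discharges 1 named fact of ★ `Involutions`.

## References
* [Kottwitz1992] R. E. Kottwitz, Points on some Shimura varieties over finite fields, J. Amer. Math. Soc. 5 (1992) 373–444, Lemma 2.6 p. 380–381.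
-/

namespace Literature.NumberTheory.Kottwitz1992.Involutions

universe u

variable {B : Type u} [Ring B] [Algebra ℝ B] (ι : B →ₗ[ℝ] B)

/-! ## §1 Orthogonal complements and restrictions of positive definite Hermitian forms (Lemma 2.1) -/

section Aux

variable {V : Type u} [AddCommGroup V] [Module ℝ V] [Module B V] [IsScalarTower ℝ B V]

omit [IsScalarTower ℝ B V] in
/-- The orthogonal complement `S^⊥ = {v | (s, v) = 0 ∀ s ∈ S}` of a `B`-submodule for a Hermitian form is a `B`-submodule (p. 379 L29–L30,
«its orthogonal complement»). [cite: Kottwitz1992, Lemma 2.1 (p. 379)] -/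
private theorem exists_perp_submodule {φ : LinearMap.BilinForm ℝ V} (hφ : IsHermitianForm B V ι φ)
    (S : Submodule B V) : ∃ T : Submodule B V, ∀ v : V, v ∈ T ↔ ∀ s ∈ S, φ s v = 0 :=
  ⟨{ carrier := {v | ∀ s ∈ S, φ s v = 0}
     add_mem' := fun {v w} hv hw s hs => by rw [map_add, hv s hs, hw s hs, add_zero]
     zero_mem' := fun s _ => by rw [map_zero]
     smul_mem' := fun b v hv s hs => by
       show φ s (b • v) = 0
       rw [hφ.symm, hφ.smul_left, hφ.symm]
       exact hv _ (S.smul_mem (ι b) hs) }, fun _ => Iff.rfl⟩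

/-- «A Hermitian `B`-module `V` is the direct sum of `W` and its orthogonal complement» (p. 379 L29–L30), for a positive definite form:
`V = S ⊕ S^⊥` as `B`-modules (Mathlib `LinearMap.BilinForm.isCompl_orthogonal_of_restrict_nondegenerate` over `ℝ`).
[cite: Kottwitz1992, Lemma 2.1 (p. 379)] -/
private theorem isCompl_perp [FiniteDimensional ℝ V] {φ : LinearMap.BilinForm ℝ V} (hφ : IsPosDefHermitianForm B V ι φ)
    (S T : Submodule B V) (hT : ∀ v : V, v ∈ T ↔ ∀ s ∈ S, φ s v = 0) : IsCompl S T := by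
  refine IsCompl.of_eq ?_ ?_
  · rw [eq_bot_iff]
    intro v hv
    obtain ⟨hvS, hvT⟩ := Submodule.mem_inf.1 hv
    rw [Submodule.mem_bot]
    by_contra hv0
    exact (hφ.2 v hv0).ne' ((hT v).1 hvT v hvS)
  · have hrefl : φ.IsRefl := fun x y h => by rw [hφ.1.symm]; exact h
    have hnd : (φ.restrict (S.restrictScalars ℝ)).Nondegenerate := by
      refine ⟨fun x hx => ?_, fun y hy => ?_⟩
      · by_contra hx0
        have hx' : (x : V) ≠ 0 := fun h0 => hx0 (Subtype.ext h0)
        exact (hφ.2 _ hx').ne' (by simpa using hx x)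
      · by_contra hy0
        have hy' : (y : V) ≠ 0 := fun h0 => hy0 (Subtype.ext h0)
        exact (hφ.2 _ hy').ne' (by simpa using hy y)
    have hc := LinearMap.BilinForm.isCompl_orthogonal_of_restrict_nondegenerate hrefl hnd
    rw [eq_top_iff]
    rintro v -
    have hv' : v ∈ S.restrictScalars ℝ ⊔ φ.orthogonal (S.restrictScalars ℝ) := by
      rw [hc.sup_eq_top]; exact Submodule.mem_top
    obtain ⟨y, hy, z, hz, rfl⟩ := Submodule.mem_sup.1 hv'
    exact Submodule.mem_sup.2 ⟨y, hy, z, (hT z).2 fun s hs => LinearMap.BilinForm.mem_orthogonal_iff.1 hz s hs, rfl⟩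

/-- A positive definite Hermitian form pulled back along an injective `B`-linear map (e.g. restricted to a `B`-submodule, or transported
along a `B`-isomorphism) is again positive definite Hermitian. [cite: Kottwitz1992, Lemma 2.6 (p. 380)] -/
private theorem posDef_comp {W : Type u} [AddCommGroup W] [Module ℝ W] [Module B W] [IsScalarTower ℝ B W]
    {φ : LinearMap.BilinForm ℝ V} (hφ : IsPosDefHermitianForm B V ι φ) (k : W →ₗ[B] V) (hk : Function.Injective k) :
    IsPosDefHermitianForm B W ι (φ.comp (k.restrictScalars ℝ) (k.restrictScalars ℝ)) :=
  ⟨⟨fun v w => hφ.1.symm _ _, fun b v w => by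
      simp only [LinearMap.BilinForm.comp_apply, LinearMap.coe_restrictScalars, map_smul]
      exact hφ.1.smul_left b _ _⟩,
    fun v hv => hφ.2 _ fun h => hv (hk (by rw [map_zero]; exact h))⟩

end Aux

/-! ## §2 The induction: split an irreducible summand, scale on it, recurse on the orthogonal complement -/

/-- **The printed argument, as an induction on `dim_ℝ V₁`**: positive definite Hermitian `B`-modules `V₁ ≅ V₂` (as `B`-modules) are
isometric — split `V₁ = S ⊕ S^⊥` with `S` irreducible, `V₂ = e(S) ⊕ e(S)^⊥`; on `S` «the second form is a real multiple of the first […]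
positive, hence is a square in `ℝ` […] isomorphic to the first by multiplication by a real number» (★ Lemma 2.6 (1)); on `S^⊥ ≅ V₁/S ≅
V₂/e(S) ≅ e(S)^⊥` the induction hypothesis applies. [cite: Kottwitz1992, Lemma 2.6 (2) (p. 380–381)] -/
private theorem exists_isometry_of_linearEquiv (hA : IsAlgebraWithInvolution B ι) (hP : IsPositiveInvolution B ι) :
    ∀ (d : ℕ) (V₁ : Type u) [AddCommGroup V₁] [Module ℝ V₁] [Module B V₁] [IsScalarTower ℝ B V₁] [Module.Finite B V₁]
      (V₂ : Type u) [AddCommGroup V₂] [Module ℝ V₂] [Module B V₂] [IsScalarTower ℝ B V₂] [Module.Finite B V₂]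
      (φ₁ : LinearMap.BilinForm ℝ V₁) (φ₂ : LinearMap.BilinForm ℝ V₂),
      IsPosDefHermitianForm B V₁ ι φ₁ → IsPosDefHermitianForm B V₂ ι φ₂ → (V₁ ≃ₗ[B] V₂) →
      Module.finrank ℝ V₁ = d → ∃ g : V₁ ≃ₗ[B] V₂, ∀ v w : V₁, φ₂ (g v) (g w) = φ₁ v w := by
  haveI := hA.finiteDimensional
  haveI := hA.isSemisimpleRing
  intro d
  induction d using Nat.strong_induction_on with
  | _ d ih => ?_
  intro V₁ _ _ _ _ _ V₂ _ _ _ _ _ φ₁ φ₂ h₁ h₂ e hd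
  haveI : Module.Finite ℝ V₁ := Module.Finite.trans B V₁
  haveI : Module.Finite ℝ V₂ := Module.Finite.trans B V₂
  rcases IsAtomic.eq_bot_or_exists_atom_le (⊤ : Submodule B V₁) with htop | ⟨S, hS, -⟩
  · -- `V₁ = 0`: «if the length is `0`, there is nothing to do»
    refine ⟨e, fun v w => ?_⟩
    have hv : v = 0 := (Submodule.mem_bot B).1 (htop ▸ (Submodule.mem_top : v ∈ (⊤ : Submodule B V₁)))
    have hw : w = 0 := (Submodule.mem_bot B).1 (htop ▸ (Submodule.mem_top : w ∈ (⊤ : Submodule B V₁)))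
    simp [hv, hw]
  · -- an irreducible `S ≤ V₁`, `V₁ = S ⊕ T₁`, `S₂ = e(S)`, `V₂ = S₂ ⊕ T₂`
    haveI : IsSimpleModule B S := isSimpleModule_iff_isAtom.2 hS
    haveI : Nontrivial S := IsSimpleModule.nontrivial B S
    obtain ⟨T₁, hT₁⟩ := exists_perp_submodule ι h₁.1 S
    have hc₁ : IsCompl S T₁ := isCompl_perp ι h₁ S T₁ hT₁
    let S₂ : Submodule B V₂ := S.map (e : V₁ →ₗ[B] V₂)
    obtain ⟨T₂, hT₂⟩ := exists_perp_submodule ι h₂.1 S₂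
    have hc₂ : IsCompl S₂ T₂ := isCompl_perp ι h₂ S₂ T₂ hT₂
    haveI : Module.Finite ℝ S := Module.Finite.of_injective (S.subtype.restrictScalars ℝ) S.injective_subtype
    haveI : Module.Finite B S := Module.Finite.of_restrictScalars_finite ℝ B S
    haveI : Module.Finite ℝ T₁ := Module.Finite.of_injective (T₁.subtype.restrictScalars ℝ) T₁.injective_subtype
    haveI : Module.Finite B T₁ := Module.Finite.of_restrictScalars_finite ℝ B T₁
    haveI : Module.Finite ℝ T₂ := Module.Finite.of_injective (T₂.subtype.restrictScalars ℝ) T₂.injective_subtype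
    haveI : Module.Finite B T₂ := Module.Finite.of_restrictScalars_finite ℝ B T₂
    -- (i) on `S`: both forms are real multiples of one `φ₀` (Lemma 2.6 (1)); the ratio is positive, a square
    let eS : S ≃ₗ[B] S₂ := e.submoduleMap S
    have heS : ∀ v : S, ((eS v : S₂) : V₂) = e (v : V₁) := fun v => rfl
    let kS : S →ₗ[B] V₂ := S₂.subtype ∘ₗ eS.toLinearMap
    have hkS : Function.Injective kS := S₂.injective_subtype.comp eS.injective
    have hψ₁ := posDef_comp ι h₁ S.subtype S.injective_subtype
    have hψ₂ := posDef_comp ι h₂ kS hkS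
    obtain ⟨φ₀, hφ₀, -, huniq⟩ := Kottwitz1992_2_6_1_hermitianForms_rank_one_holds ι hA hP S inferInstance
    obtain ⟨r₁, hr₁⟩ := huniq _ hψ₁.1
    obtain ⟨r₂, hr₂⟩ := huniq _ hψ₂.1
    have e₁ : ∀ v w : S, φ₁ (v : V₁) (w : V₁) = r₁ * φ₀ v w := fun v w => by
      have := LinearMap.congr_fun (LinearMap.congr_fun hr₁ v) w
      simpa using this
    have e₂ : ∀ v w : S, φ₂ (e (v : V₁)) (e (w : V₁)) = r₂ * φ₀ v w := fun v w => by
      have := LinearMap.congr_fun (LinearMap.congr_fun hr₂ v) w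
      simpa [kS, heS] using this
    obtain ⟨s₀, hs₀⟩ := exists_ne (0 : S)
    have hp₁ : 0 < r₁ * φ₀ s₀ s₀ := by rw [← e₁]; exact hψ₁.2 s₀ hs₀
    have hp₂ : 0 < r₂ * φ₀ s₀ s₀ := by
      rw [← e₂]
      exact h₂.2 _ fun h => hs₀ (Subtype.ext (e.injective (by rw [h, Submodule.coe_zero, map_zero])))
    have ha : φ₀ s₀ s₀ ≠ 0 := fun h => by rw [h, mul_zero] at hp₁; exact lt_irrefl _ hp₁
    have hr₂0 : r₂ ≠ 0 := fun h => by rw [h, zero_mul] at hp₂; exact lt_irrefl _ hp₂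
    have hc : 0 < r₁ / r₂ := by rw [← mul_div_mul_right r₁ r₂ ha]; exact div_pos hp₁ hp₂
    have hrel : ∀ v w : S, φ₁ (v : V₁) (w : V₁) = (r₁ / r₂) * φ₂ (e (v : V₁)) (e (w : V₁)) := fun v w => by
      rw [e₁, e₂]; field_simp
    -- «the second form is isomorphic to the first by multiplication by a real number»: `gS = √(r₁/r₂) · e|_S`
    have hsq : Real.sqrt (r₁ / r₂) * Real.sqrt (r₁ / r₂) = r₁ / r₂ := Real.mul_self_sqrt hc.le
    have hsq0 : Real.sqrt (r₁ / r₂) ≠ 0 := (Real.sqrt_pos.2 hc).ne'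
    let gS : S ≃ₗ[B] S₂ :=
      { toFun := fun v => Real.sqrt (r₁ / r₂) • eS v
        map_add' := fun v w => by rw [map_add, smul_add]
        map_smul' := fun b v => by rw [map_smul, smul_comm, RingHom.id_apply]
        invFun := fun w => eS.symm ((Real.sqrt (r₁ / r₂))⁻¹ • w)
        left_inv := fun v => by simp [smul_smul, inv_mul_cancel₀ hsq0]
        right_inv := fun w => by simp [smul_smul, mul_inv_cancel₀ hsq0] }
    have hgSapply : ∀ v : S, ((gS v : S₂) : V₂) = Real.sqrt (r₁ / r₂) • e (v : V₁) := fun v => by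
      show ((Real.sqrt (r₁ / r₂) • eS v : S₂) : V₂) = _
      rw [Submodule.coe_smul_of_tower, heS]
    have hgS : ∀ v w : S, φ₂ ((gS v : S₂) : V₂) ((gS w : S₂) : V₂) = φ₁ (v : V₁) (w : V₁) := fun v w => by
      rw [hgSapply, hgSapply]
      simp only [map_smul, LinearMap.smul_apply, smul_eq_mul]
      rw [← mul_assoc, hsq, hrel]
    -- (ii) on the complements: `T₁ ≅ V₁/S ≅ V₂/S₂ ≅ T₂`, and the induction hypothesis
    let eT : T₁ ≃ₗ[B] T₂ :=
      ((Submodule.quotientEquivOfIsCompl S T₁ hc₁).symm ≪≫ₗ Submodule.Quotient.equiv S S₂ e rfl) ≪≫ₗ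
        Submodule.quotientEquivOfIsCompl S₂ T₂ hc₂
    have hlt : Module.finrank ℝ T₁ < d := by
      rw [← hd, ← LinearMap.finrank_range_of_inj (f := T₁.subtype.restrictScalars ℝ) T₁.injective_subtype]
      refine Submodule.finrank_lt fun htop => hS.1 ?_
      rw [eq_bot_iff]
      intro s hs
      have hs' : s ∈ LinearMap.range (T₁.subtype.restrictScalars ℝ) := by rw [htop]; exact Submodule.mem_top
      obtain ⟨t, ht⟩ := LinearMap.mem_range.1 hs'
      have hsT : s ∈ T₁ := by rw [← ht]; exact t.2
      have : s ∈ S ⊓ T₁ := Submodule.mem_inf.2 ⟨hs, hsT⟩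
      rwa [hc₁.inf_eq_bot] at this
    obtain ⟨gT, hgT⟩ := ih _ hlt T₁ T₂ _ _ (posDef_comp ι h₁ T₁.subtype T₁.injective_subtype)
      (posDef_comp ι h₂ T₂.subtype T₂.injective_subtype) eT rfl
    replace hgT : ∀ v w : T₁, φ₂ ((gT v : T₂) : V₂) ((gT w : T₂) : V₂) = φ₁ (v : V₁) (w : V₁) := fun v w => hgT v w
    -- (iii) glue along `V₁ = S ⊕ T₁`, `V₂ = S₂ ⊕ T₂`; the cross terms vanish by orthogonality
    let g : V₁ ≃ₗ[B] V₂ :=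
      ((Submodule.prodEquivOfIsCompl S T₁ hc₁).symm ≪≫ₗ gS.prodCongr gT) ≪≫ₗ Submodule.prodEquivOfIsCompl S₂ T₂ hc₂
    have hg : ∀ x : S × T₁, g (Submodule.prodEquivOfIsCompl S T₁ hc₁ x) = (gS x.1 : V₂) + (gT x.2 : V₂) := fun x => by
      simp [g]
    refine ⟨g, fun v w => ?_⟩
    obtain ⟨x, rfl⟩ := (Submodule.prodEquivOfIsCompl S T₁ hc₁).surjective v
    obtain ⟨y, rfl⟩ := (Submodule.prodEquivOfIsCompl S T₁ hc₁).surjective w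
    rw [hg, hg, Submodule.coe_prodEquivOfIsCompl', Submodule.coe_prodEquivOfIsCompl']
    simp only [map_add, LinearMap.add_apply]
    rw [hgS, hgT, (hT₂ _).1 (gT y.2).2 _ (gS x.1).2, h₂.1.symm ((gT x.2 : T₂) : V₂) ((gS y.1 : S₂) : V₂),
      (hT₂ _).1 (gT x.2).2 _ (gS y.1).2, (hT₁ _).1 y.2.2 _ x.1.2, h₁.1.symm ((x.2 : T₁) : V₁) ((y.1 : S) : V₁),
      (hT₁ _).1 x.2.2 _ y.1.2]

/-! ## §3 The discharge -/

/-- **LEMMA 2.6 (2), PROVED**: ★ `Kottwitz1992_2_6_2_iso_iff` holds — for a positive involution `*` of the finite-dimensional semisimple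
`ℝ`-algebra `B`, two positive definite Hermitian `B`-modules are isomorphic as Hermitian `B`-modules (a `B`-isomorphism carrying one form to
the other) iff they are isomorphic as `B`-modules: «⇒» forgets the forms, «⇐» is §2. [cite: Kottwitz1992, Lemma 2.6 (2) (p. 380–381)] -/
theorem Kottwitz1992_2_6_2_iso_iff_holds : Kottwitz1992_2_6_2_iso_iff B ι := by
  intro hA hP V₁ _ _ _ _ _ V₂ _ _ _ _ _ φ₁ φ₂ h₁ h₂
  refine ⟨fun ⟨e, _⟩ => ⟨e⟩, fun ⟨e⟩ => ?_⟩
  haveI := hA.finiteDimensional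
  haveI : Module.Finite ℝ V₁ := Module.Finite.trans B V₁
  exact exists_isometry_of_linearEquiv ι hA hP _ V₁ V₂ φ₁ φ₂ h₁ h₂ e rfl

end Literature.NumberTheory.Kottwitz1992.Involutions
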